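import Summits.HodgeConjecture.HodgeConjecture.Theorems.R90S9HcoeffMemAtDatumA2       -- ★ M2a (p07): `hcoeffMem_gammaSphA2`; cone carries `gammaSph`, `tuple_mem_support_of_slots`, `globalCharactersLinIndep_isCountablyLinIndepOn`
import Summits.HodgeConjecture.HodgeConjecture.Theorems.R90S9ArchSlotOfContribA2       -- ★ p864582 (R90-IF-p01, ι-export): `archSlot_of_contribA_guarded`, `not_contrib_of_traces_eq_zero` at the carpet `Γ`
import HarnessLib

/-!
# R90-TF S9 — JQ-S7-7c, S9 HALF AT THE DATUM: the ι-export ★ `archSlot_of_contribA_guarded` read at `Γ₀^{sph} = gammaSph X` («A2» binders of ★ M2a)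

Dealer R90-IF-plan (g2) 02:55:28Z «GO ★ (o2)» (ED. 5 groundwork by name).  This file instantiates ★ `archSlot_of_contribA_guarded` (`Theorems/R90S9ArchSlotOfContribA2.lean`, the S9
half of JQ-S7-7c at the carpet `Γ`) at the sphere datum EXACTLY as ★ M2a `hcoeffMem_gammaSphA2` (`Theorems/R90S9HcoeffMemAtDatumA2.lean`) instantiates ★ M1
`contribMem_of_slotsA_guarded`: same `𝓕 := ⟨ArchTestKc ∧ locally-constant-compact-support ∧ cofinitely e⟩`, `W := univ`, `Θ := archTr₀ · ∏ᶠ smoothTrace`, `θ := smoothTrace`,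
`W₀ := htupW₀`, `hli := globalCharactersLinIndep_isCountablyLinIndepOn …` (★ p862002), support law ★ `tuple_mem_support_of_slots` at `a₀` and at `a₂`.

* `archSlot_gammaSphA2_guarded` — binders = ★ M2a `hcoeffMem_gammaSphA2` VERBATIM minus the two bridge-only letters `hanis`, `hspec` (they feed only ★ `memPrime_piXiPrime_of_components_eq`,
  which the arch-slot reading does not use); conclusion: a contributing member `π′` of the `ξ`-expansion (`evpRep π′ P ∧ m′ π′ ≠ 0`) satisfies
  `cpt ∧ ((tup π′).1 = a₀ ∨ (tup π′).1 = a₂) ∧ ∀ v, (tup π′).2 v = (Ξ (oneDimOf ξ h₁) v).πn ∨ (p v ∧ (tup π′).2 v = πs.getD πn)` — print p. 244 last display: the members of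
  `Π(ξ)` contributing to (14.6.3) have archimedean component in `{πⁿ(ξ_ι), πˢ(ξ_ι)}` (§12.3 Prop. 12.3.3) and this happens only in the compact-type case.  The proof term carries
  `set_option maxHeartbeats 1600000 in` — the SAME local setting ★ M2a carries for the same unification (default heartbeats time out at `whnf` on the `gammaSph` projections).
* `not_contrib_gammaSph_of_traces_eq_zero` — the slot-free vanishing branch at the datum (★ `not_contrib_of_traces_eq_zero`): if BOTH sides of (14.6.3) vanish on the restricted pure
  tensors (`hR₀G′ hR₀H′`, un-guarded), no `π′` with `evpRep π′ P` contributes (`m′ π′ = 0`).  Default heartbeats.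

CONSUMERS (by name): S7 FILE E's hypothesis `SGInfLetter` (LH7-plan (g5); JQ-S7-7c residue probe C146-p01 (g2) 02:27:42Z), and S9 FILE B ED. 5.  LANE RULE honoured: X-generic, ★-only
imports, no `Lines` module; the σ at `X := X_cm …` lives inside B (ED. 5): `tup := tupleOf …`, `htrX := htrX_cm …` (`rfl`), `htupInj`∕`htupW₀` by the F1b∕ARCH letters,
`a₀ a₂ := (archPacketOfRecord ι μω jInf dsInf (oneDimOf ξ h₁)).πn ∕ .πs`, `cpt := cptXi₀ …`; the identification «token `(tupleOf … π′).1` = GK-class of `(P_∞)_K`» is ★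
`exists_token_tupleOf_fst_of_ARCH` (needs `hARCH`).

HONEST LABEL: HC_CM is proved only modulo the 7 printed citations (2 remaining named inputs: hLiu418 = stmt-HodgeConjecture-24832, h413 = stmt-HodgeConjecture-24833) until rung 0
closes.  This is bookkeeping over ★ M1∕M2a∕`R90S9ArchSlotOfContribA2`: the local identities `hR₁ hR₂ hR₀G hR₀H`, (14.6.3) `h63`, transfer existence `hex` and the tuple letters are
HYPOTHESES; nothing unconditional is exported and no socket is paid.  Axioms `propext`, `Classical.choice`, `Quot.sound`.

[cite: Rogawski1990, §14.6 Thm. 14.6.4 and its proof pp. 244–245 (chunks p0238 L9 – p0239 L4); §12.3 Prop. 12.3.3 p. 178; Prop. 13.8.1 p. 206; §14.4 Props. 14.4.1 (a)(c), 14.4.2 (c) p. 236]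
[cite: FlathCorvallis1979, Thm. 3]
-/

set_option autoImplicit false
-- the mandated namespace repeats `HodgeConjecture.HodgeConjecture`, as in every `Theorems/*.lean` of this sub-problem
set_option linter.dupNamespace false

noncomputable section

namespace Summit.HodgeConjecture.HodgeConjecture.R90.S9

open Finset
open Literature.NumberTheory.Automorphic
open NumberField IsDedekindDomain MeasureTheory
open Literature.NumberTheory.Rogawski1990 Literature.NumberTheory.Automorphic.UnitaryGroup
open Literature.RepresentationTheory.KonnoKonno2007
open Summit.HodgeConjecture.HodgeConjecture.Cruxes.H413 Summit.HodgeConjecture.HodgeConjecture.Cruxes.H413.F0P3ClassTokenChoice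
open Summit.HodgeConjecture.HodgeConjecture.Cruxes.H413.F0P3GlobalPacket Summit.HodgeConjecture.HodgeConjecture.Cruxes.H413.F0P3LocalPacketKit
open InnerFormSec146
open scoped Matrix Classical ComplexOrder

section Datum

variable (L : Type) [Field L] [NumberField L] [IsCMField L] (ι₀ : L →+* ℂ) (H : Matrix (Fin 3) (Fin 3) L)
  (T : GL (Fin 3) ℂ) (hT : (T : Matrix (Fin 3) (Fin 3) ℂ)ᴴ * H.map ι₀ * (T : Matrix (Fin 3) (Fin 3) ℂ) = Literature.Geometry.ComplexHyperbolic.BallModel.J)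
  (νinf : @Measure (UnitaryGroup.arch (↥(maximalRealSubfield L)) L (IsCMField.complexConj L) 3 H) (borel _))
  (μv : ∀ v : HeightOneSpectrum (𝓞 ↥(maximalRealSubfield L)), @Measure ((cmDatum L 3 H).Local v) (borel _))
  (hdef : ∀ τ' : L →+* ℂ, InfinitePlace.mk τ' ≠ InfinitePlace.mk ι₀ → (H.map τ').PosDef)
  (hν : @Measure.IsHaarMeasure _ _ _ (borel _) νinf)
  (hμ : ∀ v : HeightOneSpectrum (𝓞 ↥(maximalRealSubfield L)), @Measure.IsHaarMeasure _ _ _ (borel _) (μv v))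
  (e : ∀ v : HeightOneSpectrum (𝓞 ↥(maximalRealSubfield L)), (cmDatum L 3 H).Local v → ℂ)
  (he : ∀ v, IsLocallyConstant (e v) ∧ HasCompactSupport (e v))

variable {TG TH : Type}
  (μA : Measure (adelicGroupData (↥(maximalRealSubfield L)) L (IsCMField.complexConj L) 3 H).automorphicQuotient)
  [(adelicGroupData (↥(maximalRealSubfield L)) L (IsCMField.complexConj L) 3 H).IsAutomorphicMeasure μA]
  (Ξ : OneDimAutRepH L → PacketPrimeFin L H) {H' : Matrix (Fin 3) (Fin 3) L}
  (𝔩 : ∀ v : HeightOneSpectrum (𝓞 ↥(maximalRealSubfield L)), LocalPacketKit L H' v)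

set_option maxHeartbeats 1600000 in  -- as ★ M2a `hcoeffMem_gammaSphA2` (same instantiation, same unification load)
include hdef hν hμ he in
/-- **THE ARCH-SLOT ROW OF THE (CMP) A2 COMPARISON AT THE DATUM `Γ₀^{sph} = gammaSph X`** — ★ `archSlot_of_contribA_guarded` (ι-export, p864582) instantiated token for token as
★ M2a `hcoeffMem_gammaSphA2` instantiates ★ M1: binders = M2a's minus the bridge-only `hanis hspec`; conclusion: every contributing member `π′` of the `ξ`-expansion has
`cpt`, archimedean component `(tup π′).1 ∈ {a₀, a₂}` (= `{πⁿ(ξ_ι), πˢ(ξ_ι)}`, §12.3 Prop. 12.3.3; print p. 244 last display) and finite components in the slots `πⁿ(ξ_v)` ∕ `πˢ(ξ_v)`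
(the latter only at non-split `v`).
[cite: Rogawski1990, §14.6 Thm. 14.6.4 and its proof pp. 244–245; §12.3 Prop. 12.3.3 p. 178; §14.4 Props. 14.4.1 (a)(c), 14.4.2 (c) p. 236] [cite: FlathCorvallis1979, Thm. 3] -/
theorem archSlot_gammaSphA2_guarded
    (X : DatumInputs ((UnitaryGroup.arch (↥(maximalRealSubfield L)) L (IsCMField.complexConj L) 3 H → ℂ) ×
        (∀ v : HeightOneSpectrum (𝓞 ↥(maximalRealSubfield L)), (cmDatum L 3 H).Local v → ℂ)) TG TH L ι₀ H T hT μA Ξ 𝔩)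
    (Transfer : (UnitaryGroup.arch (↥(maximalRealSubfield L)) L (IsCMField.complexConj L) 3 H → ℂ) ×
        (∀ v : HeightOneSpectrum (𝓞 ↥(maximalRealSubfield L)), (cmDatum L 3 H).Local v → ℂ) → TG → Prop)
    (TransferH : (UnitaryGroup.arch (↥(maximalRealSubfield L)) L (IsCMField.complexConj L) 3 H → ℂ) ×
        (∀ v : HeightOneSpectrum (𝓞 ↥(maximalRealSubfield L)), (cmDatum L 3 H).Local v → ℂ) → TH → Prop)
    -- the components map «`π′ ↦ (π′_ι, (π′_v)_v)`» with its injectivity and support [R90-IF-p02 `tupleOf`; F1b + «ARCH»; R90-IF-p05]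
    (tup : RepPrimeSph L ι₀ H T hT μA →
      GKIrrClass (uFormGroup (Fin 2) (Fin 1)) × (∀ v : HeightOneSpectrum (𝓞 ↥(maximalRealSubfield L)), IrrClass ((cmDatum L 3 H).Local v)))
    (htupInj : Function.Injective tup)
    (htupW₀ : ∀ π' : RepPrimeSph L ι₀ H T hT μA,
      (∃ r : GKIrrep (uFormGroup (Fin 2) (Fin 1)), GKIrrClass.mk r = (tup π').1 ∧ IsAdmissibleGK r.ρK ∧ r.IsInfUnitaryAlongP) ∧
        (∀ v, ((tup π').2 v).IsUnitarizable) ∧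
        {v | (letI : MeasurableSpace ((cmDatum L 3 H).Local v) := borel _; ((tup π').2 v).smoothTrace (μv v) (e v)) ≠ 1}.Finite)
    -- the pin «`tr′ = Θ₀ ∘ tup`» (ruling S9-R-TG; `rfl` at `X_cm`)
    (htrX : ∀ (π' : RepPrimeSph L ι₀ H T hT μA) (φf : (UnitaryGroup.arch (↥(maximalRealSubfield L)) L (IsCMField.complexConj L) 3 H → ℂ) ×
        (∀ v : HeightOneSpectrum (𝓞 ↥(maximalRealSubfield L)), (cmDatum L 3 H).Local v → ℂ)),
      X.trPrime π' φf = archTr₀ L ι₀ H T hT νinf (tup π').1 φf.1 *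
        ∏ᶠ v, (letI : MeasurableSpace ((cmDatum L 3 H).Local v) := borel _; ((tup π').2 v).smoothTrace (μv v) (φf.2 v)))
    -- the A-packet `Π(ξ)`: `ξ` one-dimensional, `m_v n_v ≠ 0` on `S₀` [Thm. 14.6.4 p. 244]
    {P : X.G.Packet} {ξ : X.G.PacketH} (h₁ : X.IsOneDimH ξ) (hS : ∀ q : InnerFormSec146.Place L, q ∈ S0 L H → X.MnNeZero ξ q)
    -- the slots: non-split predicate, `⊗_{S₀}F_v`, and the letters on `πⁿ(ξ_v)` ∕ `πˢ(ξ_v)` [§13.1 p. 199; p. 244]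
    (p : HeightOneSpectrum (𝓞 ↥(maximalRealSubfield L)) → Prop)
    -- «A2»: the TWO archimedean members `πⁿ(ξ_ι)`, `πˢ(ξ_ι)` at the non-compact place `ι` [§12.3 Prop. 12.3.3], both admissible ∧ inf-unitary, distinct
    (a₀ a₂ : GKIrrClass (uFormGroup (Fin 2) (Fin 1)))
    (ha₀ : ∃ r : GKIrrep (uFormGroup (Fin 2) (Fin 1)), GKIrrClass.mk r = a₀ ∧ IsAdmissibleGK r.ρK ∧ r.IsInfUnitaryAlongP)
    (ha₂ : ∃ r : GKIrrep (uFormGroup (Fin 2) (Fin 1)), GKIrrClass.mk r = a₂ ∧ IsAdmissibleGK r.ρK ∧ r.IsInfUnitaryAlongP)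
    (hane : a₂ ≠ a₀)
    (hun : ∀ v, ((Ξ (X.oneDimOf ξ h₁) v).πn).IsUnitarizable)
    (hus : ∀ v, p v → ((Ξ (X.oneDimOf ξ h₁) v).πs.getD (Ξ (X.oneDimOf ξ h₁) v).πn).IsUnitarizable)
    (hsph : {v | (letI : MeasurableSpace ((cmDatum L 3 H).Local v) := borel _;
      ((Ξ (X.oneDimOf ξ h₁) v).πn).smoothTrace (μv v) (e v)) ≠ 1}.Finite)
    (hne : ∀ i : {v // p v}, (Ξ (X.oneDimOf ξ h₁) (i : _)).πs.getD (Ξ (X.oneDimOf ξ h₁) (i : _)).πn ≠ (Ξ (X.oneDimOf ξ h₁) (i : _)).πn)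
    -- exceptional sets, the two local laws, the truncated-product local identities [S2 ∕ S3 ∕ S7]
    (T₀ : (UnitaryGroup.arch (↥(maximalRealSubfield L)) L (IsCMField.complexConj L) 3 H → ℂ) ×
        (∀ v : HeightOneSpectrum (𝓞 ↥(maximalRealSubfield L)), (cmDatum L 3 H).Local v → ℂ) →
      Finset (HeightOneSpectrum (𝓞 ↥(maximalRealSubfield L))))
    (hn1 : ∀ φf, (ArchTestKc L ι₀ H T hT φf.1 ∧ (∀ v, IsLocallyConstant (φf.2 v) ∧ HasCompactSupport (φf.2 v)) ∧ {v | φf.2 v ≠ e v}.Finite) →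
      ∀ v ∉ T₀ φf, (letI : MeasurableSpace ((cmDatum L 3 H).Local v) := borel _;
        ((Ξ (X.oneDimOf ξ h₁) v).πn).smoothTrace (μv v) (φf.2 v)) = 1)
    (hs0 : ∀ φf, (ArchTestKc L ι₀ H T hT φf.1 ∧ (∀ v, IsLocallyConstant (φf.2 v) ∧ HasCompactSupport (φf.2 v)) ∧ {v | φf.2 v ≠ e v}.Finite) →
      ∀ i : {v // p v}, (i : HeightOneSpectrum (𝓞 ↥(maximalRealSubfield L))) ∉ T₀ φf →
        (letI : MeasurableSpace ((cmDatum L 3 H).Local i) := borel _;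
          ((Ξ (X.oneDimOf ξ h₁) (i : _)).πs.getD (Ξ (X.oneDimOf ξ h₁) (i : _)).πn).smoothTrace (μv i) (φf.2 i)) = 0)
    -- «A2»: the compact-type guard and the four local-identity readings [§14.4 Props. 14.4.1 (a)(c), 14.4.2 (c); Prop. 13.1.4; p. 244 last display]
    (cpt : Prop)
    (hR₁ : cpt → ∀ φf (f : TG), (ArchTestKc L ι₀ H T hT φf.1 ∧ (∀ v, IsLocallyConstant (φf.2 v) ∧ HasCompactSupport (φf.2 v)) ∧ {v | φf.2 v ≠ e v}.Finite) →
      Transfer φf f →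
      X.G.packetTrace X.tr P f =
        (-1) ^ (gammaSph _ TG TH L ι₀ H T hT μA Ξ 𝔩 X).N *
          ((archTr₀ L ι₀ H T hT νinf a₀ φf.1 - archTr₀ L ι₀ H T hT νinf a₂ φf.1) *
            ∏ v ∈ T₀ φf with ¬ p v, (letI : MeasurableSpace ((cmDatum L 3 H).Local v) := borel _;
              ((Ξ (X.oneDimOf ξ h₁) v).πn).smoothTrace (μv v) (φf.2 v))) *
          ∏ i ∈ (T₀ φf).subtype p, (letI : MeasurableSpace ((cmDatum L 3 H).Local i) := borel _;
            (((Ξ (X.oneDimOf ξ h₁) (i : _)).πn).smoothTrace (μv i) (φf.2 i) -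
              ((Ξ (X.oneDimOf ξ h₁) (i : _)).πs.getD (Ξ (X.oneDimOf ξ h₁) (i : _)).πn).smoothTrace (μv i) (φf.2 i))))
    (hR₂ : cpt → ∀ φf (fH : TH), (ArchTestKc L ι₀ H T hT φf.1 ∧ (∀ v, IsLocallyConstant (φf.2 v) ∧ HasCompactSupport (φf.2 v)) ∧ {v | φf.2 v ≠ e v}.Finite) →
      TransferH φf fH →
      X.trH ξ fH =
        (-1) ^ (gammaSph _ TG TH L ι₀ H T hT μA Ξ 𝔩 X).N * (gammaSph _ TG TH L ι₀ H T hT μA Ξ 𝔩 X).c *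
          ((archTr₀ L ι₀ H T hT νinf a₀ φf.1 + archTr₀ L ι₀ H T hT νinf a₂ φf.1) *
            ∏ v ∈ T₀ φf with ¬ p v, (letI : MeasurableSpace ((cmDatum L 3 H).Local v) := borel _;
              ((Ξ (X.oneDimOf ξ h₁) v).πn).smoothTrace (μv v) (φf.2 v))) *
          ∏ i ∈ (T₀ φf).subtype p, (letI : MeasurableSpace ((cmDatum L 3 H).Local i) := borel _;
            (((Ξ (X.oneDimOf ξ h₁) (i : _)).πn).smoothTrace (μv i) (φf.2 i) +
              ((Ξ (X.oneDimOf ξ h₁) (i : _)).πs.getD (Ξ (X.oneDimOf ξ h₁) (i : _)).πn).smoothTrace (μv i) (φf.2 i))))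
    (hR₀G : ¬ cpt → ∀ φf (f : TG), (ArchTestKc L ι₀ H T hT φf.1 ∧ (∀ v, IsLocallyConstant (φf.2 v) ∧ HasCompactSupport (φf.2 v)) ∧ {v | φf.2 v ≠ e v}.Finite) →
      Transfer φf f → X.G.packetTrace X.tr P f = 0)
    (hR₀H : ¬ cpt → ∀ φf (fH : TH), (ArchTestKc L ι₀ H T hT φf.1 ∧ (∀ v, IsLocallyConstant (φf.2 v) ∧ HasCompactSupport (φf.2 v)) ∧ {v | φf.2 v ≠ e v}.Finite) →
      TransferH φf fH → X.trH ξ fH = 0)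
    -- (14.6.3) on the restricted pure tensors, `HasSum` form [R90-IF-p07 #4′], and transfer existence [S6]
    (h63 : ∀ φf, (ArchTestKc L ι₀ H T hT φf.1 ∧ (∀ v, IsLocallyConstant (φf.2 v) ∧ HasCompactSupport (φf.2 v)) ∧ {v | φf.2 v ≠ e v}.Finite) →
      ∀ (f : TG) (fH : TH), Transfer φf f → TransferH φf fH →
      HasSum (fun π' => {π' : (gammaSph _ TG TH L ι₀ H T hT μA Ξ 𝔩 X).Rep' | (gammaSph _ TG TH L ι₀ H T hT μA Ξ 𝔩 X).evpRep π' P}.indicator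
          (fun π' => ((gammaSph _ TG TH L ι₀ H T hT μA Ξ 𝔩 X).m' π' : ℂ) * (gammaSph _ TG TH L ι₀ H T hT μA Ξ 𝔩 X).tr' π' φf) π')
        (1 / 2 * X.G.packetTrace X.tr P f + 1 / 2 * X.trH ξ fH))
    (hex : ∀ φf, (ArchTestKc L ι₀ H T hT φf.1 ∧ (∀ v, IsLocallyConstant (φf.2 v) ∧ HasCompactSupport (φf.2 v)) ∧ {v | φf.2 v ≠ e v}.Finite) →
      ∃ (f : TG) (fH : TH), Transfer φf f ∧ TransferH φf fH) :
    ∀ π' : (gammaSph _ TG TH L ι₀ H T hT μA Ξ 𝔩 X).Rep',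
      (gammaSph _ TG TH L ι₀ H T hT μA Ξ 𝔩 X).evpRep π' P → (gammaSph _ TG TH L ι₀ H T hT μA Ξ 𝔩 X).m' π' ≠ 0 →
        cpt ∧ ((tup π').1 = a₀ ∨ (tup π').1 = a₂) ∧
          ∀ v, (tup π').2 v = (Ξ (X.oneDimOf ξ h₁) v).πn ∨
            (p v ∧ (tup π').2 v = (Ξ (X.oneDimOf ξ h₁) v).πs.getD (Ξ (X.oneDimOf ξ h₁) v).πn) := by
  -- ★ p862002 in `IsCountablyLinIndepOn` currency: the tuple-side linear independence
  have hli := globalCharactersLinIndep_isCountablyLinIndepOn L ι₀ H T hT νinf μv hdef hν hμ e he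
  exact archSlot_of_contribA_guarded (gammaSph _ TG TH L ι₀ H T hT μA Ξ 𝔩 X) Transfer TransferH p h₁ hS
    (fun φf => ArchTestKc L ι₀ H T hT φf.1 ∧ (∀ v, IsLocallyConstant (φf.2 v) ∧ HasCompactSupport (φf.2 v)) ∧ {v | φf.2 v ≠ e v}.Finite)
    Set.univ (fun _ _ _ => Set.mem_univ _) tup htupInj.injOn
    (fun x φf => archTr₀ L ι₀ H T hT νinf x.1 φf.1 *
      ∏ᶠ v, (letI : MeasurableSpace ((cmDatum L 3 H).Local v) := borel _; (x.2 v).smoothTrace (μv v) (φf.2 v)))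
    (fun φf a => archTr₀ L ι₀ H T hT νinf a φf.1)
    (fun φf v y => (letI : MeasurableSpace ((cmDatum L 3 H).Local v) := borel _; y.smoothTrace (μv v) (φf.2 v)))
    (fun _ _ _ => rfl) (fun π' _ φf _ => htrX π' φf) _ hli (fun π' _ => htupW₀ π')
    a₀ a₂ hane (fun v => (Ξ (X.oneDimOf ξ h₁) v).πn) (fun v => (Ξ (X.oneDimOf ξ h₁) v).πs.getD (Ξ (X.oneDimOf ξ h₁) v).πn) hne
    (fun x hx₁ hx₂ hxfin => by
      rcases hx₁ with hx₁ | hx₁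
      · exact tuple_mem_support_of_slots L H μv e p a₀ ha₀ _ _ hun hus hsph x hx₁ hx₂ hxfin
      · exact tuple_mem_support_of_slots L H μv e p a₂ ha₂ _ _ hun hus hsph x hx₁ hx₂ hxfin)
    T₀ hn1 hs0 cpt hR₁ hR₂ hR₀G hR₀H h63 hex

include hdef hν hμ he in
/-- **THE SLOT-FREE VANISHING BRANCH AT THE DATUM** — ★ `not_contrib_of_traces_eq_zero` (p864582) at `Γ₀^{sph} = gammaSph X`: if both sides of (14.6.3) vanish on every restricted
pure tensor (`hR₀G′ ∕ hR₀H′`, un-guarded), then NO `π′` with `evpRep π′ P` contributes (`m′(π′) = 0`) — linear independence of characters (★ p862002) applied to the `HasSum`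
expansion `h63` with value `0`.  Binders: the tuple letters `tup htupInj htupW₀ htrX`, the two vanishing readings, `h63`, `hex`.
[cite: Rogawski1990, §14.6 proof of Thm. 14.6.4 pp. 244–245; §14.4 Props. 14.4.1 (c), 14.4.2 (c) p. 236] [cite: FlathCorvallis1979, Thm. 3] -/
theorem not_contrib_gammaSph_of_traces_eq_zero
    (X : DatumInputs ((UnitaryGroup.arch (↥(maximalRealSubfield L)) L (IsCMField.complexConj L) 3 H → ℂ) ×
        (∀ v : HeightOneSpectrum (𝓞 ↥(maximalRealSubfield L)), (cmDatum L 3 H).Local v → ℂ)) TG TH L ι₀ H T hT μA Ξ 𝔩)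
    (Transfer : (UnitaryGroup.arch (↥(maximalRealSubfield L)) L (IsCMField.complexConj L) 3 H → ℂ) ×
        (∀ v : HeightOneSpectrum (𝓞 ↥(maximalRealSubfield L)), (cmDatum L 3 H).Local v → ℂ) → TG → Prop)
    (TransferH : (UnitaryGroup.arch (↥(maximalRealSubfield L)) L (IsCMField.complexConj L) 3 H → ℂ) ×
        (∀ v : HeightOneSpectrum (𝓞 ↥(maximalRealSubfield L)), (cmDatum L 3 H).Local v → ℂ) → TH → Prop)
    (tup : RepPrimeSph L ι₀ H T hT μA →
      GKIrrClass (uFormGroup (Fin 2) (Fin 1)) × (∀ v : HeightOneSpectrum (𝓞 ↥(maximalRealSubfield L)), IrrClass ((cmDatum L 3 H).Local v)))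
    (htupInj : Function.Injective tup)
    (htupW₀ : ∀ π' : RepPrimeSph L ι₀ H T hT μA,
      (∃ r : GKIrrep (uFormGroup (Fin 2) (Fin 1)), GKIrrClass.mk r = (tup π').1 ∧ IsAdmissibleGK r.ρK ∧ r.IsInfUnitaryAlongP) ∧
        (∀ v, ((tup π').2 v).IsUnitarizable) ∧
        {v | (letI : MeasurableSpace ((cmDatum L 3 H).Local v) := borel _; ((tup π').2 v).smoothTrace (μv v) (e v)) ≠ 1}.Finite)
    (htrX : ∀ (π' : RepPrimeSph L ι₀ H T hT μA) (φf : (UnitaryGroup.arch (↥(maximalRealSubfield L)) L (IsCMField.complexConj L) 3 H → ℂ) ×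
        (∀ v : HeightOneSpectrum (𝓞 ↥(maximalRealSubfield L)), (cmDatum L 3 H).Local v → ℂ)),
      X.trPrime π' φf = archTr₀ L ι₀ H T hT νinf (tup π').1 φf.1 *
        ∏ᶠ v, (letI : MeasurableSpace ((cmDatum L 3 H).Local v) := borel _; ((tup π').2 v).smoothTrace (μv v) (φf.2 v)))
    {P : X.G.Packet} {ξ : X.G.PacketH}
    (hR₀G' : ∀ φf (f : TG), (ArchTestKc L ι₀ H T hT φf.1 ∧ (∀ v, IsLocallyConstant (φf.2 v) ∧ HasCompactSupport (φf.2 v)) ∧ {v | φf.2 v ≠ e v}.Finite) →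
      Transfer φf f → X.G.packetTrace X.tr P f = 0)
    (hR₀H' : ∀ φf (fH : TH), (ArchTestKc L ι₀ H T hT φf.1 ∧ (∀ v, IsLocallyConstant (φf.2 v) ∧ HasCompactSupport (φf.2 v)) ∧ {v | φf.2 v ≠ e v}.Finite) →
      TransferH φf fH → X.trH ξ fH = 0)
    (h63 : ∀ φf, (ArchTestKc L ι₀ H T hT φf.1 ∧ (∀ v, IsLocallyConstant (φf.2 v) ∧ HasCompactSupport (φf.2 v)) ∧ {v | φf.2 v ≠ e v}.Finite) →
      ∀ (f : TG) (fH : TH), Transfer φf f → TransferH φf fH →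
      HasSum (fun π' => {π' : (gammaSph _ TG TH L ι₀ H T hT μA Ξ 𝔩 X).Rep' | (gammaSph _ TG TH L ι₀ H T hT μA Ξ 𝔩 X).evpRep π' P}.indicator
          (fun π' => ((gammaSph _ TG TH L ι₀ H T hT μA Ξ 𝔩 X).m' π' : ℂ) * (gammaSph _ TG TH L ι₀ H T hT μA Ξ 𝔩 X).tr' π' φf) π')
        (1 / 2 * X.G.packetTrace X.tr P f + 1 / 2 * X.trH ξ fH))
    (hex : ∀ φf, (ArchTestKc L ι₀ H T hT φf.1 ∧ (∀ v, IsLocallyConstant (φf.2 v) ∧ HasCompactSupport (φf.2 v)) ∧ {v | φf.2 v ≠ e v}.Finite) →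
      ∃ (f : TG) (fH : TH), Transfer φf f ∧ TransferH φf fH) :
    ∀ π' : (gammaSph _ TG TH L ι₀ H T hT μA Ξ 𝔩 X).Rep',
      (gammaSph _ TG TH L ι₀ H T hT μA Ξ 𝔩 X).evpRep π' P → (gammaSph _ TG TH L ι₀ H T hT μA Ξ 𝔩 X).m' π' = 0 := by
  have hli := globalCharactersLinIndep_isCountablyLinIndepOn L ι₀ H T hT νinf μv hdef hν hμ e he
  exact not_contrib_of_traces_eq_zero (gammaSph _ TG TH L ι₀ H T hT μA Ξ 𝔩 X) Transfer TransferH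
    (fun φf => ArchTestKc L ι₀ H T hT φf.1 ∧ (∀ v, IsLocallyConstant (φf.2 v) ∧ HasCompactSupport (φf.2 v)) ∧ {v | φf.2 v ≠ e v}.Finite)
    Set.univ (fun _ _ _ => Set.mem_univ _) tup htupInj.injOn
    (fun x φf => archTr₀ L ι₀ H T hT νinf x.1 φf.1 *
      ∏ᶠ v, (letI : MeasurableSpace ((cmDatum L 3 H).Local v) := borel _; (x.2 v).smoothTrace (μv v) (φf.2 v)))
    (fun π' _ φf _ => htrX π' φf) _ hli (fun π' _ => htupW₀ π') hR₀G' hR₀H' h63 hex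

end Datum

end Summit.HodgeConjecture.HodgeConjecture.R90.S9

end
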